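import Literature.Analysis.ODE.TorusFlowGradientEstimateOfDeriv
import Literature.Analysis.ODE.TorusFlowGronwallWithin
import Literature.Analysis.FunctionSpaces.TorusEnstrophyOrthogonality
import Mathlib.Analysis.Complex.ExponentialBounds
import HarnessLib

/-!
# The SHARP second-gradient estimate of a flow on a forward window: `|∂_e∂_c D(t,x)| ≤ 12 d² ‖∇²f‖_∞ · t`

Analysis/ODE proof file (theorems only; no definitions, no named facts).  For a displacement `D` solving the flow equation of a
field `f` on a window `[0,T₀]` in the "chain rule on steroids" form of `TorusFlowGradientEstimateWithin`
(`∂ₜ ∂^l D = ∂^l (f ∘ X)` as a derivative WITHIN `[0,T₀]`), with `|∇f| ≤ B₁`, `|∇²f| ≤ B₂`, `|∇D| ≤ 1` on the window and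
`d·B₁·T₀ ≤ 1`, the second label-derivatives of the displacement obey the LINEAR-IN-TIME bound
`|∂_e ∂_c D_q(t,x)| ≤ 12 d² B₂ t` (Grönwall on `∂ₜ ∇²D = (∇²f∘X)[∇X,∇X] + (∇f∘X)∇²D`, `∇²D(0) = 0`).  This is the estimate behind the
sharp curvature bound of the exact-flow frame of a Lagrangian lattice carrier (K1L_D `stmt-AnomalousDissipation-27980`, hypothesis
`hcurv` of `FrameForm.isModulation_frameG`): there `B₂ ∼ N_m Σ a_i`, so the bound carries the strain factor.

## References
* P. Hartman, *Ordinary Differential Equations* (2nd ed., SIAM 2002), Ch. V Thm 3.1 (differentiability of solutions in initial data;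
  the second variational equation) and Cor. 4.1. [`Hartman2002`]
* S. Armstrong, V. Vicol, *Anomalous diffusion by fractal homogenization*, Ann. PDE 11 (2025), arXiv:2305.05048, App. A Prop. 7.10.
  [`ArmstrongVicol2025`]
-/

noncomputable section

open Set Function Filter MeasureTheory Finset
open scoped Topology

namespace Literature.Analysis.ODE

namespace TorusFlow

open Literature.Analysis.FunctionSpaces Literature.Analysis.FunctionSpaces.Torus

variable {d : Type*} [Fintype d] [DecidableEq d]
variable {f D : ℝ → UnitAddTorus d → EuclideanSpace ℝ d}

omit [Fintype d] in
/-- The constant has no partial derivatives. [folklore] -/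
private theorem partialDeriv_const_fun (c : ℝ) (e : d) (x : UnitAddTorus d) : partialDeriv e (fun _ : UnitAddTorus d => c) x = 0 := by
  simp [partialDeriv, Torus.lineDeriv]

/-- **The second variational equation, entrywise**: for smooth `f(u,·)`, `D(u,·)`,
`∂_e∂_c [f_q(u, · + D(u,·))](x) = Σ_m ( Σ_p (∂_p∂_m f_q)(X x)·(δ_pe + ∂_e D_p(x)) )·(δ_mc + ∂_c D_m(x)) + Σ_m (∂_m f_q)(X x)·∂_e∂_c D_m(x)`.
[cite: Hartman2002, Ch. V Thm 3.1] -/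
theorem iterPartialDeriv_pair_comp_add_proj (hfs : ∀ t, IsSmooth (f t)) (hDs : ∀ t, IsSmooth (D t)) (e c q : d) (u : ℝ)
    (x : UnitAddTorus d) :
    iterPartialDeriv [e, c] (fun z => f u (z + proj (D u z)) q) x =
      ∑ m, ((∑ p, partialDeriv p (partialDeriv m (fun z => f u z q)) (x + proj (D u x)) *
              ((1 : Matrix d d ℝ) p e + partialDeriv e (fun z => D u z p) x)) *
            ((1 : Matrix d d ℝ) m c + partialDeriv c (fun z => D u z m) x) +
          partialDeriv m (fun z => f u z q) (x + proj (D u x)) * partialDeriv e (partialDeriv c (fun z => D u z m)) x) := by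
  classical
  have hfq : IsSmooth (fun z => f u z q) := (hfs u).apply q
  have hD1 : IsContDiff 1 (D u) := (hDs u).isContDiff (by simp)
  -- the inner derivative as a function of the base point
  have hinner : partialDeriv c (fun z => f u (z + proj (D u z)) q) =
      fun z => ∑ m, partialDeriv m (fun z => f u z q) (z + proj (D u z)) * ((1 : Matrix d d ℝ) m c + partialDeriv c (fun z => D u z m) z) := by
    funext z
    have h := iterPartialDeriv_singleton_comp_add_proj hfs hDs c q u z
    simpa only [iterPartialDeriv_cons, iterPartialDeriv_nil] using h
  -- smoothness of the factors
  have hA : ∀ m, IsContDiff 1 (fun z => partialDeriv m (fun z => f u z q) (z + proj (D u z))) := fun m =>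
    isContDiff_comp_add_proj ((hfq.partialDeriv m).isContDiff (by simp)) hD1
  have hJ : ∀ m, IsContDiff 1 (fun z => (1 : Matrix d d ℝ) m c + partialDeriv c (fun z => D u z m) z) := fun m =>
    (isContDiff_const _).add ((((hDs u).apply m).partialDeriv c).isContDiff (by simp))
  have hAJ : ∀ m, IsContDiff 1 (fun z => partialDeriv m (fun z => f u z q) (z + proj (D u z)) *
      ((1 : Matrix d d ℝ) m c + partialDeriv c (fun z => D u z m) z)) := fun m =>
    (ContDiff.mul (hA m) (hJ m) : IsContDiff 1 fun z => partialDeriv m (fun z => f u z q) (z + proj (D u z)) *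
      ((1 : Matrix d d ℝ) m c + partialDeriv c (fun z => D u z m) z))
  simp only [iterPartialDeriv_cons, iterPartialDeriv_nil]
  rw [hinner, partialDeriv_finset_sum _ (fun m _ => hAJ m) e x]
  refine Finset.sum_congr rfl fun m _ => ?_
  rw [partialDeriv_mul (hA m) (hJ m) e x]
  -- the two derivatives of the factors
  have h1 : partialDeriv e (fun z => partialDeriv m (fun z => f u z q) (z + proj (D u z))) x =
      ∑ p, partialDeriv p (partialDeriv m (fun z => f u z q)) (x + proj (D u x)) * ((1 : Matrix d d ℝ) p e + partialDeriv e (fun z => D u z p) x) := by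
    rw [partialDeriv_comp_add_proj ((hfq.partialDeriv m).isContDiff (by simp)) hD1 e x]
    refine Finset.sum_congr rfl fun p _ => ?_
    rw [smul_eq_mul, mul_comm, partialDeriv_apply_coord hD1 e x p, Matrix.one_apply, PiLp.single_apply]
  have h2 : partialDeriv e (fun z => (1 : Matrix d d ℝ) m c + partialDeriv c (fun z => D u z m) z) x =
      partialDeriv e (partialDeriv c (fun z => D u z m)) x := by
    have := congrFun (partialDeriv_add (isContDiff_const ((1 : Matrix d d ℝ) m c)) ((((hDs u).apply m).partialDeriv c).isContDiff (by simp)) e) x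
    simp only [Pi.add_apply] at this
    rw [show (fun z => (1 : Matrix d d ℝ) m c + partialDeriv c (fun z => D u z m) z) =
        ((fun _ : UnitAddTorus d => (1 : Matrix d d ℝ) m c) + partialDeriv c (fun z => D u z m)) from rfl, this,
      partialDeriv_const_fun, zero_add]
  rw [h1, h2]; ring

/-- **The sharp second-gradient bound on a forward window.**  If `|∂_m f_q| ≤ B₁`, `|∂_p∂_m f_q| ≤ B₂` (all times), `|∂_c D_q| ≤ 1` on
`[0,T₀]`, and `d·B₁·T₀ ≤ 1`, then `|∂_e∂_c D_q(t,x)| ≤ 12 d² B₂ t` for `t ∈ [0,T₀]`.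
[cite: Hartman2002, Ch. V Thm 3.1, Cor. 4.1] -/
theorem abs_partialDeriv_partialDeriv_disp_le_forward_ofDerivWithin
    (hfs : ∀ t, IsSmooth (f t)) (hDs : ∀ t, IsSmooth (D t)) (hD0 : ∀ x, D 0 x = 0)
    {T₀ B₁ B₂ : ℝ} (hB₁ : 0 ≤ B₁) (hB₂ : 0 ≤ B₂)
    (hDt : ∀ (l : List d) (i : d) (x : UnitAddTorus d), ∀ t ∈ Icc 0 T₀,
      HasDerivWithinAt (fun s => iterPartialDeriv l (fun y => D s y i) x)
        (iterPartialDeriv l (fun y => f t (y + proj (D t y)) i) x) (Icc 0 T₀) t)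
    (hf1 : ∀ (t : ℝ) (m a : d) (z : UnitAddTorus d), |partialDeriv m (fun y => f t y a) z| ≤ B₁)
    (hf2 : ∀ (t : ℝ) (p m a : d) (z : UnitAddTorus d), |partialDeriv p (partialDeriv m (fun y => f t y a)) z| ≤ B₂)
    (hD1 : ∀ t ∈ Icc 0 T₀, ∀ (c q : d) (z : UnitAddTorus d), |partialDeriv c (fun y => D t y q) z| ≤ 1)
    (hT : (Fintype.card d : ℝ) * B₁ * T₀ ≤ 1)
    {t : ℝ} (ht : t ∈ Icc 0 T₀) (e c q : d) (x : UnitAddTorus d) :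
    |partialDeriv e (partialDeriv c (fun y => D t y q)) x| ≤ 12 * (Fintype.card d : ℝ) ^ 2 * B₂ * t := by
  classical
  set dd : ℝ := (Fintype.card d : ℝ) with hdd
  -- the curve `u ↦ (∂_e∂_c D_q(u,x))_q`
  set y : ℝ → d → ℝ := fun u q => iterPartialDeriv [e, c] (fun z => D u z q) x with hy
  set y' : ℝ → d → ℝ := fun u q => iterPartialDeriv [e, c] (fun z => f u (z + proj (D u z)) q) x with hy'
  have hyd : ∀ u ∈ Icc 0 T₀, HasDerivWithinAt y (y' u) (Icc 0 T₀) u := fun u hu =>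
    hasDerivWithinAt_pi.2 fun q => hDt [e, c] q x u hu
  have hy0 : y 0 = 0 := funext fun q => iterPartialDeriv_disp_zero hD0 (l := [e, c]) (by simp) q x
  have hyq : ∀ u m, partialDeriv e (partialDeriv c (fun z => D u z m)) x = y u m := fun u m => by
    simp only [hy, iterPartialDeriv_cons, iterPartialDeriv_nil]
  -- entries of `∇X` are at most `2` on the window
  have hJ : ∀ u ∈ Icc 0 T₀, ∀ m c' : d, |(1 : Matrix d d ℝ) m c' + partialDeriv c' (fun z => D u z m) x| ≤ 2 := by
    intro u hu m c'
    refine (abs_add_le _ _).trans ?_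
    have h1 : |(1 : Matrix d d ℝ) m c'| ≤ 1 := by rw [Matrix.one_apply]; split_ifs <;> simp
    linarith [hD1 u hu c' m x]
  set Kc : ℝ := dd * B₁ with hKc
  have hKc0 : 0 ≤ Kc := by positivity
  have hb : ∀ u ∈ Ico 0 T₀, ‖y' u‖ ≤ Kc * ‖y u‖ + 4 * dd ^ 2 * B₂ := by
    intro u hu
    have hu' : u ∈ Icc 0 T₀ := Ico_subset_Icc_self hu
    refine (pi_norm_le_iff_of_nonneg (by positivity)).2 fun q => ?_
    rw [Real.norm_eq_abs, hy']
    simp only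
    rw [iterPartialDeriv_pair_comp_add_proj hfs hDs e c q u x]
    -- first the forcing, then the linear part
    have hF : ∀ m, |(∑ p, partialDeriv p (partialDeriv m (fun z => f u z q)) (x + proj (D u x)) *
          ((1 : Matrix d d ℝ) p e + partialDeriv e (fun z => D u z p) x)) *
        ((1 : Matrix d d ℝ) m c + partialDeriv c (fun z => D u z m) x)| ≤ dd * (B₂ * 2) * 2 := by
      intro m
      rw [abs_mul]
      refine mul_le_mul ?_ (hJ u hu' m c) (abs_nonneg _) (by positivity)
      calc |∑ p, partialDeriv p (partialDeriv m (fun z => f u z q)) (x + proj (D u x)) *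
              ((1 : Matrix d d ℝ) p e + partialDeriv e (fun z => D u z p) x)|
          ≤ ∑ p, |partialDeriv p (partialDeriv m (fun z => f u z q)) (x + proj (D u x)) *
              ((1 : Matrix d d ℝ) p e + partialDeriv e (fun z => D u z p) x)| := Finset.abs_sum_le_sum_abs _ _
        _ ≤ ∑ _p : d, B₂ * 2 := Finset.sum_le_sum fun p _ => by
            rw [abs_mul]; exact mul_le_mul (hf2 u p m q _) (hJ u hu' p e) (abs_nonneg _) hB₂
        _ = dd * (B₂ * 2) := by rw [Finset.sum_const, Finset.card_univ, nsmul_eq_mul, hdd]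
    have hL : ∀ m, |partialDeriv m (fun z => f u z q) (x + proj (D u x)) * partialDeriv e (partialDeriv c (fun z => D u z m)) x| ≤
        B₁ * |y u m| := by
      intro m
      rw [abs_mul, hyq]
      exact mul_le_mul_of_nonneg_right (hf1 u m q _) (abs_nonneg _)
    calc |∑ m, ((∑ p, partialDeriv p (partialDeriv m (fun z => f u z q)) (x + proj (D u x)) *
              ((1 : Matrix d d ℝ) p e + partialDeriv e (fun z => D u z p) x)) *
            ((1 : Matrix d d ℝ) m c + partialDeriv c (fun z => D u z m) x) +
          partialDeriv m (fun z => f u z q) (x + proj (D u x)) * partialDeriv e (partialDeriv c (fun z => D u z m)) x)|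
        ≤ ∑ m, (dd * (B₂ * 2) * 2 + B₁ * |y u m|) := by
          refine (Finset.abs_sum_le_sum_abs _ _).trans (Finset.sum_le_sum fun m _ => (abs_add_le _ _).trans (add_le_add (hF m) (hL m)))
      _ = 4 * dd ^ 2 * B₂ + B₁ * ∑ m, |y u m| := by
          rw [Finset.sum_add_distrib, Finset.sum_const, Finset.card_univ, nsmul_eq_mul, ← Finset.mul_sum, ← hdd]; ring
      _ ≤ 4 * dd ^ 2 * B₂ + B₁ * (dd * ‖y u‖) := by
          gcongr
          calc ∑ m, |y u m| ≤ ∑ _m : d, ‖y u‖ := Finset.sum_le_sum fun m _ => by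
                rw [← Real.norm_eq_abs]; exact norm_le_pi_norm (y u) m
            _ = dd * ‖y u‖ := by rw [Finset.sum_const, Finset.card_univ, nsmul_eq_mul, hdd]
      _ = Kc * ‖y u‖ + 4 * dd ^ 2 * B₂ := by rw [hKc]; ring
  have hG := norm_le_exp_mul_integral_of_hasDerivWithinAt_Icc_le hKc0 continuous_const (fun _ => by positivity) hyd hy0 hb ht
  rw [intervalIntegral.integral_const, smul_eq_mul, sub_zero] at hG
  -- `Kc t ≤ 1`, `e ≤ 3`
  have hT' : dd * B₁ * T₀ ≤ 1 := by simpa only [hKc] using hT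
  have hKt : Kc * t ≤ 1 := by
    have h1 : Kc * t ≤ Kc * T₀ := mul_le_mul_of_nonneg_left ht.2 hKc0
    have h2 : Kc * T₀ ≤ 1 := by rw [hKc]; exact hT'
    linarith
  have hexp : Real.exp (Kc * t) ≤ 3 := by
    have := Real.exp_le_exp.2 hKt
    have h3 : Real.exp 1 < 3 := lt_trans Real.exp_one_lt_d9 (by norm_num)
    linarith
  calc |partialDeriv e (partialDeriv c (fun y => D t y q)) x| = |y t q| := by rw [hyq]
    _ ≤ ‖y t‖ := by rw [← Real.norm_eq_abs]; exact norm_le_pi_norm (y t) q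
    _ ≤ Real.exp (Kc * t) * (t * (4 * dd ^ 2 * B₂)) := hG
    _ ≤ 3 * (t * (4 * dd ^ 2 * B₂)) := mul_le_mul_of_nonneg_right hexp (by have := ht.1; positivity)
    _ = 12 * dd ^ 2 * B₂ * t := by ring

end TorusFlow

end Literature.Analysis.ODE

end
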